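import Summits.Ventures.Crystal3D.Theorems.StickyWulffConstantTextureBuildHealSurgery
import Summits.Ventures.Crystal3D.Theorems.StickyWulffConstantTextureLiminfResolutionOfRigidity
import HarnessLib

/-!
# TB-1 brick L-HEAL, bookkeeping: the refill GAIN form of the cut bill, the half-defect budget of disjoint blocker sets, and the count of balls near the defects
# (lane T, crux `TextureLiminfV5`, stmt-Ventures-23912; memo HOME/wulff-p2/g24/HEAL-g24.md §1 and §4 (b)(c))

HONEST FRAMING. Venture `Summits/Ventures/Crystal3D` (cell `crystal3d-full`), route `route-Ventures-StickyWulffConstant`, helper `--supports` the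
law-v5 crux `TextureLiminfV5` (stmt-Ventures-23912).  Pure finite combinatorics over '…TextureBuildHealSurgery' and '…TextureLiminfResolutionOfRigidity'
(census-free, standard axioms).  Nothing about any cover or texture is claimed; F-C1 not moved.

The three small facts the healed constructor's S3 ledger needs besides the surgeries themselves:

* **`contactDeficiency_cut_heal_le_gain`** — the cut bill BEFORE the kissing step: `D(K ∪ V) ≤ D(X) − hd_X(R) + ½·cross(K, R) + ½·Σ_{v ∈ V} (#abandoned(v) −
  cdeg_K v)`.  It keeps the refill GAIN `−½·cdeg_K v` (a refilled crack site with six kept neighbours and three abandoned ones gains `3/2`), which the kissing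
  form '…HealCut' spends against `cross(K, R)`; use this one when little junk is removed (cracks, vacancy pockets);
* `sum_sum_halfDefect_le_contactDeficiency` — pairwise disjoint blocker sets inside a packing have total half-defect `≤ D(X) = 6N − b` (the gains `−hd(R f)` of
  all windows together are at most the whole deficiency — the form in which the per-window bills of `exists_site_heal_family` are summed);
* **`card_filter_near_le`** — in a unit packing, the balls within `H ≥ 1` of a given finite set `T` of balls number `≤ #T·(2H+1)³` (so: everything the cover ever
  removes lies within `H` of a defective ball, and the defective balls are `O(Def)`-many ⇒ the healed count loses `O_H(Def) = O(N^{2/3})` balls, memo §1).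
-/

noncomputable section

namespace Summit.Ventures.Crystal3D.Theorems

open Finset Summit.Ventures.Crystal3D
open Literature.MathematicalPhysics.StatisticalMechanics (IsHaggSeq contactDeficiency)
open Summit.Ventures.Crystal3D.Cruxes.TextureLiminf.TexShadow (E3 stacking)

section Gain

variable {L : E3 ≃ₗᵢ[ℝ] E3} {s : E3} {σ : ℤ → ℤ} {X R V : Finset E3}

/-- **CUT BILL WITH THE REFILL GAIN** (no kissing step): `D(K ∪ V) ≤ D(X) − Σ_{a∈R} halfDefect_X a + ½·cross(K, R) + ½·Σ_{v∈V} (#abandoned(v) − cdeg_K v)`. -/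
theorem contactDeficiency_cut_heal_le_gain (hσ : IsHaggSeq σ) (hR : R ⊆ X) (hV : Disjoint V (X \ R))
    (hVS : ∀ v ∈ V, v ∈ stacking L s σ) :
    contactDeficiency ((X \ R) ∪ V) ≤ contactDeficiency X - ∑ a ∈ R, halfDefect X a + (crossCount (X \ R) R : ℝ) / 2 +
      (∑ v ∈ V, ((abandoned (stacking L s σ) (X \ R) V v : ℝ) - (cdeg (X \ R) v : ℝ))) / 2 := by
  classical
  rw [contactDeficiency_exchange_eq hR hV]
  have hKX : X \ R ⊆ X := Finset.sdiff_subset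
  have hXK : X \ (X \ R) = R := Finset.sdiff_sdiff_eq_self hR
  have hrem : ∑ a ∈ R, ((cdeg X a : ℝ) - (cdeg R a : ℝ) / 2 - 6) =
      (crossCount (X \ R) R : ℝ) / 2 - ∑ a ∈ R, halfDefect X a := by
    rw [crossCount_comm, crossCount_eq_sum, Nat.cast_sum, Finset.sum_div, ← Finset.sum_sub_distrib]
    refine Finset.sum_congr rfl fun a _ => ?_
    have hdeg : (cdeg X a : ℝ) = (cdeg (X \ R) a : ℝ) + (cdeg R a : ℝ) := by
      have := cdeg_eq_add_sdiff hKX a; rw [hXK] at this; exact_mod_cast this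
    have hKa : (((X \ R).filter fun q => dist a q = 1).card : ℕ) = cdeg (X \ R) a := rfl
    rw [hKa]
    unfold halfDefect
    rw [hdeg]; ring
  have hrefill : ∑ v ∈ V, ((6 : ℝ) - (cdeg (X \ R) v : ℝ) - (cdeg V v : ℝ) / 2) ≤
      (∑ v ∈ V, ((abandoned (stacking L s σ) (X \ R) V v : ℝ) - (cdeg (X \ R) v : ℝ))) / 2 := by
    rw [Finset.sum_div]
    refine Finset.sum_le_sum fun v hv => ?_
    have h12 : (12 : ℝ) ≤ (cdeg (X \ R) v : ℝ) + (cdeg V v : ℝ) + (abandoned (stacking L s σ) (X \ R) V v : ℝ) := by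
      exact_mod_cast twelve_le_cdeg_add_cdeg_add_abandoned hσ (hVS v hv) (X \ R) V
    linarith
  rw [hrem]
  linarith

end Gain

/-! ## The half-defect budget of disjoint blocker sets -/

/-- Pairwise disjoint subsets of a packing have total half-defect at most the packing's deficiency. -/
theorem sum_sum_halfDefect_le_contactDeficiency {ι : Type*} (T : Finset ι) (A : ι → Finset E3) (X' : Finset E3)
    (hX : ∀ p ∈ X', ∀ q ∈ X', p ≠ q → 1 ≤ dist p q) (hA : ∀ i ∈ T, A i ⊆ X')
    (hdisj : ∀ i ∈ T, ∀ j ∈ T, i ≠ j → Disjoint (A i) (A j)) :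
    ∑ i ∈ T, ∑ a ∈ A i, halfDefect X' a ≤ contactDeficiency X' := by
  classical
  rw [← Finset.sum_biUnion hdisj]
  exact sum_halfDefect_le_contactDeficiency X' hX (Finset.biUnion_subset.2 hA)

/-! ## Balls near a finite set of balls -/

section Near

variable {N : ℕ} {x : Fin N → E3}

open scoped Classical in
/-- **Balls near a finite set of balls**: in a unit packing the balls within `H ≥ 1` of some ball of `T` number at most `#T·(2H+1)³`. -/
theorem card_filter_near_le (hx : IsUnitPacking x) (T : Finset (Fin N)) {H : ℝ} (hH : 1 ≤ H) :
    ((Finset.univ.filter fun i => ∃ j ∈ T, dist (x i) (x j) ≤ H).card : ℝ) ≤ (T.card : ℝ) * (2 * H + 1) ^ 3 := by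
  classical
  have hsub : (Finset.univ.filter fun i => ∃ j ∈ T, dist (x i) (x j) ≤ H) ⊆
      T.biUnion fun j => Finset.univ.filter fun i => dist (x i) (x j) ≤ H := by
    intro i hi
    obtain ⟨j, hj, hd⟩ := (Finset.mem_filter.1 hi).2
    exact Finset.mem_biUnion.2 ⟨j, hj, Finset.mem_filter.2 ⟨Finset.mem_univ _, hd⟩⟩
  calc ((Finset.univ.filter fun i => ∃ j ∈ T, dist (x i) (x j) ≤ H).card : ℝ)
      ≤ ((T.biUnion fun j => Finset.univ.filter fun i => dist (x i) (x j) ≤ H).card : ℝ) := by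
        exact_mod_cast Finset.card_le_card hsub
    _ ≤ ∑ j ∈ T, (((Finset.univ.filter fun i => dist (x i) (x j) ≤ H).card : ℕ) : ℝ) := by
        exact_mod_cast Finset.card_biUnion_le
    _ ≤ ∑ _j ∈ T, (2 * H + 1) ^ 3 := Finset.sum_le_sum fun j _ => card_filter_dist_le hx j hH
    _ = (T.card : ℝ) * (2 * H + 1) ^ 3 := by rw [Finset.sum_const, nsmul_eq_mul]

/-- Point-set form: the balls within `H ≥ 1` of a finite set `P` of balls of the packing number at most `#P·(2H+1)³`. -/
theorem card_filter_near_points_le (hx : IsUnitPacking x) (P : Finset E3) (hP : ∀ p ∈ P, p ∈ Set.range x) {H : ℝ} (hH : 1 ≤ H) :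
    ((Finset.univ.filter fun i => ∃ p ∈ P, dist (x i) p ≤ H).card : ℝ) ≤ (P.card : ℝ) * (2 * H + 1) ^ 3 := by
  classical
  -- index the points of `P`
  set T : Finset (Fin N) := Finset.univ.filter fun j => x j ∈ P with hT
  have hTcard : T.card ≤ P.card := by
    have : T.image x ⊆ P := by
      intro p hp
      obtain ⟨j, hj, rfl⟩ := Finset.mem_image.1 hp
      exact (Finset.mem_filter.1 hj).2
    calc T.card = (T.image x).card := (Finset.card_image_of_injective _ hx.injective).symm
      _ ≤ P.card := Finset.card_le_card this
  have hsub : (Finset.univ.filter fun i => ∃ p ∈ P, dist (x i) p ≤ H) ⊆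
      Finset.univ.filter fun i => ∃ j ∈ T, dist (x i) (x j) ≤ H := by
    intro i hi
    obtain ⟨p, hp, hd⟩ := (Finset.mem_filter.1 hi).2
    obtain ⟨j, rfl⟩ := hP p hp
    exact Finset.mem_filter.2 ⟨Finset.mem_univ _, j, Finset.mem_filter.2 ⟨Finset.mem_univ _, hp⟩, hd⟩
  have hpow : (0 : ℝ) ≤ (2 * H + 1) ^ 3 := by positivity
  calc ((Finset.univ.filter fun i => ∃ p ∈ P, dist (x i) p ≤ H).card : ℝ)
      ≤ ((Finset.univ.filter fun i => ∃ j ∈ T, dist (x i) (x j) ≤ H).card : ℝ) := by exact_mod_cast Finset.card_le_card hsub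
    _ ≤ (T.card : ℝ) * (2 * H + 1) ^ 3 := card_filter_near_le hx T hH
    _ ≤ (P.card : ℝ) * (2 * H + 1) ^ 3 := by
        have : (T.card : ℝ) ≤ (P.card : ℝ) := by exact_mod_cast hTcard
        exact mul_le_mul_of_nonneg_right this hpow

end Near

end Summit.Ventures.Crystal3D.Theorems

end
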